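import Literature.GroupTheory.CombinatorialGroupTheory.PuncturedSurfaceGroupUnrQuotientCoprod
import Literature.GroupTheory.CombinatorialGroupTheory.PuncturedSurfaceGroupNodeLoopBasis
import Mathlib.Data.Int.Cast.Lemmas
import HarnessLib

/-!
# The unramified quotient of `Γ_{g,r}` at the TWO-NODE-CYCLE shape: `Γ_{g,r}/⟨⟨b_m, δ, c_j⟩⟩ ≅ Γ_{m,0} ∗ (ℤ ∗ Γ_{g₁,0})`

Mochizuki, *Semi-graphs of anabelioids* [SemiAnbd] Example 2.10 p. 31 (the groups `Γ_{g,r}`)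
[cite: MochizukiSemiAnbd2006, Ex. 2.10 p.31]; used for [CombGC] Prop. 1.2, proof p. 9 (the `Π^unr`
separating coverings, row F-2828) at the pointed stable curve with two components joined by TWO nodes
(abc-iut-f-164 gen 5, companion of `PuncturedSurfaceGroupUnrQuotientCoprod.lean`, the one-node case).
With `g = m + (1 + g₁)`, the node loops `b_m` and
`δ = (c_0⋯c_{s-1})⁻¹ ([a_{m+1},b_{m+1}]⋯[a_{g-1},b_{g-1}])⁻¹ b_m` and all cusps `c_j` killed, the handle
`a_m` becomes a free letter and the relator splits:
`Γ_{g,r}/⟨⟨b_m, δ, c_j⟩⟩ ≅ Γ_{m,0} ∗ (ℤ ∗ Γ_{g₁,0})`, the classes of `a_i, b_i` (`i < m`) going to the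
generators of the first factor, `a_m` to the generator of `ℤ`, `a_i, b_i` (`i > m`) to those of `Γ_{g₁,0}`
(`exists_mulEquiv_cycleUnrQuotient_coprod`).  Elementary Tietze transformations; nothing here concerns
[IUTchIII].
-/

namespace Literature.GroupTheory.CombinatorialGroupTheory

namespace PuncturedSurfaceGroup

open Monoid (Coprod)

/-- The closed-surface relator through a homomorphism: `∏_i φ([a_i,b_i]) = 1`.
[cite: MochizukiSemiAnbd2006, Ex. 2.10 p.31] -/
theorem map_prod_comm_eq_one_zero {M : Type*} [Monoid M] (g : ℕ) (φ : PuncturedSurfaceGroup g 0 →* M) :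
    ((List.finRange g).map fun i : Fin g => φ (a (r := 0) i * b i * (a i)⁻¹ * (b i)⁻¹)).prod = 1 := by
  rw [show (fun i : Fin g => φ (a (r := 0) i * b i * (a i)⁻¹ * (b i)⁻¹)) =
      φ ∘ fun i : Fin g => a (r := 0) i * b i * (a i)⁻¹ * (b i)⁻¹ from rfl, ← List.map_map, ← map_list_prod,
    comm_prod_eq_one_zero, map_one]

/-- **`Γ_{m+(1+g₁),r}/⟨⟨b_m, δ, c_0,…,c_{r-1}⟩⟩ ≅ Γ_{m,0} ∗ (ℤ ∗ Γ_{g₁,0})`**, the classes of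
`a_i, b_i` (`i < m`), of `a_m`, and of `a_{m+1+j}, b_{m+1+j}` going to the generators of the three
factors. [cite: MochizukiSemiAnbd2006, Ex. 2.10 p.31] -/
theorem exists_mulEquiv_cycleUnrQuotient_coprod (m g₁ r s : ℕ) (δ : PuncturedSurfaceGroup (m + (1 + g₁)) r)
    (hδ : δ = (((List.finRange r).map fun j : Fin r =>
        if (j : ℕ) < s then c (g := m + (1 + g₁)) j else 1).prod)⁻¹ *
      (((List.finRange (m + (1 + g₁))).map fun i : Fin (m + (1 + g₁)) => if m + 1 ≤ (i : ℕ) then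
        a (r := r) i * b i * (a i)⁻¹ * (b i)⁻¹ else 1).prod)⁻¹ *
      b ⟨m, by omega⟩) :
    ∃ (_hK : (Subgroup.normalClosure ({b ⟨m, by omega⟩, δ} ∪
        Set.range (c : Fin r → PuncturedSurfaceGroup (m + (1 + g₁)) r))).Normal)
      (e : PuncturedSurfaceGroup (m + (1 + g₁)) r ⧸
          Subgroup.normalClosure ({b ⟨m, by omega⟩, δ} ∪
            Set.range (c : Fin r → PuncturedSurfaceGroup (m + (1 + g₁)) r)) ≃*
        Coprod (PuncturedSurfaceGroup m 0) (Coprod (Multiplicative ℤ) (PuncturedSurfaceGroup g₁ 0))),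
      (∀ (i : Fin m) (bit : Bool),
        e (QuotientGroup.mk (PresentedGroup.of (Sum.inl (Fin.castAdd (1 + g₁) i, bit)))) =
          Coprod.inl (PresentedGroup.of (Sum.inl (i, bit)))) ∧
      e (QuotientGroup.mk (PresentedGroup.of (Sum.inl (⟨m, by omega⟩, false)))) =
          Coprod.inr (Coprod.inl (Multiplicative.ofAdd 1)) ∧
      ∀ (j : Fin g₁) (bit : Bool),
        e (QuotientGroup.mk (PresentedGroup.of (Sum.inl (Fin.natAdd m (Fin.natAdd 1 j), bit)))) =
          Coprod.inr (Coprod.inr (PresentedGroup.of (Sum.inl (j, bit)))) := by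
  classical
  set km : Fin (m + (1 + g₁)) := ⟨m, by omega⟩ with hkm
  have hkm' : Fin.natAdd m (Fin.castAdd g₁ (0 : Fin 1)) = km := Fin.ext (by simp [km])
  set K : Subgroup (PuncturedSurfaceGroup (m + (1 + g₁)) r) :=
    Subgroup.normalClosure ({b km, δ} ∪ Set.range (c : Fin r → PuncturedSurfaceGroup (m + (1 + g₁)) r))
    with hKdef
  haveI hKn : K.Normal := Subgroup.normalClosure_normal
  have hcK : ∀ j, c (g := m + (1 + g₁)) (r := r) j ∈ K := fun j =>
    Subgroup.subset_normalClosure (Or.inr ⟨j, rfl⟩)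
  have hbK : b km ∈ K := Subgroup.subset_normalClosure (Or.inl (Or.inl rfl))
  have hδK : δ ∈ K := Subgroup.subset_normalClosure (Or.inl (Or.inr rfl))
  -- the pieces of the relator
  set Xl : PuncturedSurfaceGroup (m + (1 + g₁)) r := ((List.finRange (m + (1 + g₁))).map
    fun i : Fin (m + (1 + g₁)) => if (i : ℕ) < m then a (r := r) i * b i * (a i)⁻¹ * (b i)⁻¹ else 1).prod
    with hXl
  set Xr : PuncturedSurfaceGroup (m + (1 + g₁)) r := ((List.finRange (m + (1 + g₁))).map
    fun i : Fin (m + (1 + g₁)) => if m + 1 ≤ (i : ℕ) then a (r := r) i * b i * (a i)⁻¹ * (b i)⁻¹ else 1).prod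
    with hXr
  set Cl : PuncturedSurfaceGroup (m + (1 + g₁)) r := ((List.finRange r).map fun j : Fin r =>
    if (j : ℕ) < s then c (g := m + (1 + g₁)) j else 1).prod with hCl
  set Cr : PuncturedSurfaceGroup (m + (1 + g₁)) r := ((List.finRange r).map fun j : Fin r =>
    if s ≤ (j : ℕ) then c (g := m + (1 + g₁)) j else 1).prod with hCr
  have hrel : Xl * (a km * b km * (a km)⁻¹ * (b km)⁻¹ * Xr) * (Cl * Cr) = 1 := by
    have h := comm_split_mul_cusp_split_eq_one (g := m + (1 + g₁)) (r := r) m s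
    rw [prod_map_finRange_ite_le_peel (m + (1 + g₁)) m (by omega)] at h
    exact h
  have hClK : Cl ∈ K := prod_map_finRange_ite_mem K r _ _ fun j _ => hcK j
  have hCrK : Cr ∈ K := prod_map_finRange_ite_mem K r _ _ fun j _ => hcK j
  have hXrK : Xr ∈ K := by
    have hXe : Xr = b km * δ⁻¹ * Cl⁻¹ := by rw [hδ]; group
    rw [hXe]
    exact K.mul_mem (K.mul_mem hbK (K.inv_mem hδK)) (K.inv_mem hClK)
  have hcmK : a km * b km * (a km)⁻¹ * (b km)⁻¹ ∈ K :=
    K.mul_mem (by simpa [mul_assoc] using hKn.conj_mem _ hbK (a km)) (K.inv_mem hbK)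
  have hXlK : Xl ∈ K := by
    have hXe : Xl = ((a km * b km * (a km)⁻¹ * (b km)⁻¹ * Xr) * (Cl * Cr))⁻¹ :=
      eq_inv_of_mul_eq_one_left (by rw [← mul_assoc]; exact hrel)
    rw [hXe]
    exact K.inv_mem (K.mul_mem (K.mul_mem hcmK hXrK) (K.mul_mem hClK hCrK))
  -- `Xl`, `Xr` as products over the outer blocks
  have hXl' : Xl = ((List.finRange m).map fun i : Fin m =>
      a (r := r) (Fin.castAdd (1 + g₁) i) * b (Fin.castAdd (1 + g₁) i) * (a (Fin.castAdd (1 + g₁) i))⁻¹ *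
        (b (Fin.castAdd (1 + g₁) i))⁻¹).prod := by
    rw [hXl, prod_map_finRange_add]
    have h2 : ((List.finRange (1 + g₁)).map fun j : Fin (1 + g₁) =>
        (fun i : Fin (m + (1 + g₁)) => if (i : ℕ) < m then a (r := r) i * b i * (a i)⁻¹ * (b i)⁻¹ else 1)
          (Fin.natAdd m j)).prod = 1 :=
      List.prod_eq_one fun y hy => by
        obtain ⟨j, -, rfl⟩ := List.mem_map.mp hy
        simp
    rw [h2, mul_one]
    congr 1
    refine List.map_congr_left fun i _ => ?_
    simp
  have hXr' : Xr = ((List.finRange g₁).map fun j : Fin g₁ =>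
      a (r := r) (Fin.natAdd m (Fin.natAdd 1 j)) * b (Fin.natAdd m (Fin.natAdd 1 j)) *
        (a (Fin.natAdd m (Fin.natAdd 1 j)))⁻¹ * (b (Fin.natAdd m (Fin.natAdd 1 j)))⁻¹).prod := by
    rw [hXr, prod_map_finRange_add]
    have h1 : ((List.finRange m).map fun i : Fin m =>
        (fun i : Fin (m + (1 + g₁)) => if m + 1 ≤ (i : ℕ) then a (r := r) i * b i * (a i)⁻¹ * (b i)⁻¹ else 1)
          (Fin.castAdd (1 + g₁) i)).prod = 1 :=
      List.prod_eq_one fun y hy => by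
        obtain ⟨i, -, rfl⟩ := List.mem_map.mp hy
        have := i.2
        simp only [Fin.val_castAdd]
        rw [if_neg (by omega)]
    rw [h1, one_mul, prod_map_finRange_add]
    have h0 : ((List.finRange 1).map fun z : Fin 1 =>
        (fun j : Fin (1 + g₁) => (fun i : Fin (m + (1 + g₁)) => if m + 1 ≤ (i : ℕ) then
          a (r := r) i * b i * (a i)⁻¹ * (b i)⁻¹ else 1) (Fin.natAdd m j)) (Fin.castAdd g₁ z)).prod = 1 :=
      List.prod_eq_one fun y hy => by
        obtain ⟨z, -, rfl⟩ := List.mem_map.mp hy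
        have := z.2
        simp only [Fin.val_natAdd, Fin.val_castAdd]
        rw [if_neg (by omega)]
    rw [h0, one_mul]
    congr 1
    refine List.map_congr_left fun j _ => ?_
    simp only [Fin.val_natAdd]
    rw [if_pos (by omega)]
  -- (1) `Φ : Γ → Coprod (PuncturedSurfaceGroup m 0) (Coprod (Multiplicative ℤ) (PuncturedSurfaceGroup g₁ 0))`
  let fA : Fin (m + (1 + g₁)) → Bool →
      Coprod (PuncturedSurfaceGroup m 0) (Coprod (Multiplicative ℤ) (PuncturedSurfaceGroup g₁ 0)) :=
    Fin.addCases (motive := fun _ => Bool →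
        Coprod (PuncturedSurfaceGroup m 0) (Coprod (Multiplicative ℤ) (PuncturedSurfaceGroup g₁ 0)))
      (fun i bit => Coprod.inl (PresentedGroup.of (Sum.inl (i, bit))))
      (fun k => Fin.addCases (motive := fun _ => Bool →
          Coprod (PuncturedSurfaceGroup m 0) (Coprod (Multiplicative ℤ) (PuncturedSurfaceGroup g₁ 0)))
        (fun _ bit => if bit then 1 else Coprod.inr (Coprod.inl (Multiplicative.ofAdd 1)))
        (fun j bit => Coprod.inr (Coprod.inr (PresentedGroup.of (Sum.inl (j, bit))))) k)
  have hfA_left : ∀ i bit, fA (Fin.castAdd (1 + g₁) i) bit =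
      Coprod.inl (PresentedGroup.of (Sum.inl (i, bit))) := fun i bit => by
    simp only [fA, Fin.addCases_left]
  have hfA_mid : ∀ (z : Fin 1) bit, fA (Fin.natAdd m (Fin.castAdd g₁ z)) bit =
      (if bit then 1 else Coprod.inr (Coprod.inl (Multiplicative.ofAdd 1))) := fun z bit => by
    simp only [fA, Fin.addCases_right, Fin.addCases_left]
  have hfA_right : ∀ j bit, fA (Fin.natAdd m (Fin.natAdd 1 j)) bit =
      Coprod.inr (Coprod.inr (PresentedGroup.of (Sum.inl (j, bit)))) := fun j bit => by
    simp only [fA, Fin.addCases_right]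
  let f : puncturedSurfaceGen (m + (1 + g₁)) r →
      Coprod (PuncturedSurfaceGroup m 0) (Coprod (Multiplicative ℤ) (PuncturedSurfaceGroup g₁ 0)) :=
    Sum.elim (fun q => fA q.1 q.2) fun _ => 1
  have hcommA : ∀ i : Fin m, f (Sum.inl (Fin.castAdd (1 + g₁) i, false)) * f (Sum.inl (Fin.castAdd (1 + g₁) i, true)) *
      (f (Sum.inl (Fin.castAdd (1 + g₁) i, false)))⁻¹ * (f (Sum.inl (Fin.castAdd (1 + g₁) i, true)))⁻¹ =
      Coprod.inl (a (r := 0) i * b i * (a i)⁻¹ * (b i)⁻¹) := fun i => by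
    simp only [f, Sum.elim_inl, hfA_left, map_mul, map_inv]; rfl
  have hcommM : ∀ z : Fin 1, f (Sum.inl (Fin.natAdd m (Fin.castAdd g₁ z), false)) *
      f (Sum.inl (Fin.natAdd m (Fin.castAdd g₁ z), true)) *
      (f (Sum.inl (Fin.natAdd m (Fin.castAdd g₁ z), false)))⁻¹ *
      (f (Sum.inl (Fin.natAdd m (Fin.castAdd g₁ z), true)))⁻¹ = 1 := fun z => by
    simp only [f, Sum.elim_inl, hfA_mid, Bool.false_eq_true, if_false, if_true, mul_one, inv_one]
    exact mul_inv_cancel (Coprod.inr (Coprod.inl (Multiplicative.ofAdd (1 : ℤ))) :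
        Coprod (PuncturedSurfaceGroup m 0) (Coprod (Multiplicative ℤ) (PuncturedSurfaceGroup g₁ 0)))
  have hcommB : ∀ j : Fin g₁, f (Sum.inl (Fin.natAdd m (Fin.natAdd 1 j), false)) *
      f (Sum.inl (Fin.natAdd m (Fin.natAdd 1 j), true)) *
      (f (Sum.inl (Fin.natAdd m (Fin.natAdd 1 j), false)))⁻¹ * (f (Sum.inl (Fin.natAdd m (Fin.natAdd 1 j), true)))⁻¹ =
      Coprod.inr (Coprod.inr (a (r := 0) j * b j * (a j)⁻¹ * (b j)⁻¹)) := fun j => by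
    simp only [f, Sum.elim_inl, hfA_right, map_mul, map_inv]; rfl
  have hfrel : ∀ v ∈ ({relator (m + (1 + g₁)) r} : Set (FreeGroup (puncturedSurfaceGen (m + (1 + g₁)) r))),
      FreeGroup.lift f v = 1 := by
    intro v hv
    rw [Set.mem_singleton_iff] at hv
    rw [hv, lift_relator, prod_map_finRange_add, prod_map_finRange_add]
    have h3 : ((List.finRange r).map fun j => f (Sum.inr j)).prod = 1 := by
      refine List.prod_eq_one (M :=
          Coprod (PuncturedSurfaceGroup m 0) (Coprod (Multiplicative ℤ) (PuncturedSurfaceGroup g₁ 0))) fun y hy => ?_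
      obtain ⟨j, -, rfl⟩ := List.mem_map.mp hy
      rfl
    have h1 : ((List.finRange m).map fun i : Fin m =>
        f (Sum.inl (Fin.castAdd (1 + g₁) i, false)) * f (Sum.inl (Fin.castAdd (1 + g₁) i, true)) *
          (f (Sum.inl (Fin.castAdd (1 + g₁) i, false)))⁻¹ * (f (Sum.inl (Fin.castAdd (1 + g₁) i, true)))⁻¹).prod = 1 := by
      rw [show (fun i : Fin m => f (Sum.inl (Fin.castAdd (1 + g₁) i, false)) * f (Sum.inl (Fin.castAdd (1 + g₁) i, true)) *
          (f (Sum.inl (Fin.castAdd (1 + g₁) i, false)))⁻¹ * (f (Sum.inl (Fin.castAdd (1 + g₁) i, true)))⁻¹) =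
          (Coprod.inl : PuncturedSurfaceGroup m 0 →*
              Coprod (PuncturedSurfaceGroup m 0) (Coprod (Multiplicative ℤ) (PuncturedSurfaceGroup g₁ 0))) ∘
              fun i => a (r := 0) i * b i * (a i)⁻¹ * (b i)⁻¹
          from funext fun i => hcommA i]
      exact map_prod_comm_eq_one_zero (M :=
          Coprod (PuncturedSurfaceGroup m 0) (Coprod (Multiplicative ℤ) (PuncturedSurfaceGroup g₁ 0))) m
          (Coprod.inl : PuncturedSurfaceGroup m 0 →*
              Coprod (PuncturedSurfaceGroup m 0) (Coprod (Multiplicative ℤ) (PuncturedSurfaceGroup g₁ 0)))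
    have h0 : ((List.finRange 1).map fun z : Fin 1 =>
        f (Sum.inl (Fin.natAdd m (Fin.castAdd g₁ z), false)) * f (Sum.inl (Fin.natAdd m (Fin.castAdd g₁ z), true)) *
          (f (Sum.inl (Fin.natAdd m (Fin.castAdd g₁ z), false)))⁻¹ *
          (f (Sum.inl (Fin.natAdd m (Fin.castAdd g₁ z), true)))⁻¹).prod = 1 :=
      List.prod_eq_one
        (M := Coprod (PuncturedSurfaceGroup m 0) (Coprod (Multiplicative ℤ) (PuncturedSurfaceGroup g₁ 0))) fun y hy => by
        obtain ⟨z, -, rfl⟩ := List.mem_map.mp hy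
        exact hcommM z
    have h2 : ((List.finRange g₁).map fun j : Fin g₁ =>
        f (Sum.inl (Fin.natAdd m (Fin.natAdd 1 j), false)) * f (Sum.inl (Fin.natAdd m (Fin.natAdd 1 j), true)) *
          (f (Sum.inl (Fin.natAdd m (Fin.natAdd 1 j), false)))⁻¹ *
          (f (Sum.inl (Fin.natAdd m (Fin.natAdd 1 j), true)))⁻¹).prod = 1 := by
      rw [show (fun j : Fin g₁ => f (Sum.inl (Fin.natAdd m (Fin.natAdd 1 j), false)) *
          f (Sum.inl (Fin.natAdd m (Fin.natAdd 1 j), true)) *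
          (f (Sum.inl (Fin.natAdd m (Fin.natAdd 1 j), false)))⁻¹ * (f (Sum.inl (Fin.natAdd m (Fin.natAdd 1 j), true)))⁻¹) =
          ((Coprod.inr : Coprod (Multiplicative ℤ) (PuncturedSurfaceGroup g₁ 0) →*
              Coprod (PuncturedSurfaceGroup m 0) (Coprod (Multiplicative ℤ) (PuncturedSurfaceGroup g₁ 0))).comp
            (Coprod.inr : PuncturedSurfaceGroup g₁ 0 →* Coprod (Multiplicative ℤ) (PuncturedSurfaceGroup g₁ 0))) ∘
            fun j => a (r := 0) j * b j * (a j)⁻¹ * (b j)⁻¹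
          from funext fun j => hcommB j]
      exact map_prod_comm_eq_one_zero (M :=
          Coprod (PuncturedSurfaceGroup m 0) (Coprod (Multiplicative ℤ) (PuncturedSurfaceGroup g₁ 0))) g₁
        ((Coprod.inr : Coprod (Multiplicative ℤ) (PuncturedSurfaceGroup g₁ 0) →*
            Coprod (PuncturedSurfaceGroup m 0) (Coprod (Multiplicative ℤ) (PuncturedSurfaceGroup g₁ 0))).comp
        (Coprod.inr : PuncturedSurfaceGroup g₁ 0 →* Coprod (Multiplicative ℤ) (PuncturedSurfaceGroup g₁ 0)))
    rw [h1, h0, h2, h3, one_mul, one_mul, one_mul]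
  let Φ : PuncturedSurfaceGroup (m + (1 + g₁)) r →*
      Coprod (PuncturedSurfaceGroup m 0) (Coprod (Multiplicative ℤ) (PuncturedSurfaceGroup g₁ 0)) :=
    PresentedGroup.toGroup hfrel
  have hΦof : ∀ x, Φ (PresentedGroup.of x) = f x := fun x => PresentedGroup.toGroup.of hfrel
  have hΦa : ∀ (i : Fin (m + (1 + g₁))) (bit : Bool), Φ (PresentedGroup.of (Sum.inl (i, bit))) = fA i bit :=
    fun i bit => hΦof _
  have hΦc : ∀ j, Φ (c j) = 1 := fun j => hΦof (Sum.inr j)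
  have hΦbm : Φ (b km) = 1 := by
    rw [b, ← hkm', hΦa, hfA_mid, if_pos rfl]
  have hΦam : Φ (a km) = Coprod.inr (Coprod.inl (Multiplicative.ofAdd 1)) := by
    rw [a, ← hkm', hΦa, hfA_mid]
    rfl
  -- `Φ` kills `K`
  have hΦXr : Φ Xr = 1 := by
    rw [hXr', map_list_prod, List.map_map]
    have : (Φ ∘ fun j : Fin g₁ => a (r := r) (Fin.natAdd m (Fin.natAdd 1 j)) * b (Fin.natAdd m (Fin.natAdd 1 j)) *
        (a (Fin.natAdd m (Fin.natAdd 1 j)))⁻¹ * (b (Fin.natAdd m (Fin.natAdd 1 j)))⁻¹) =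
        ((Coprod.inr : Coprod (Multiplicative ℤ) (PuncturedSurfaceGroup g₁ 0) →*
            Coprod (PuncturedSurfaceGroup m 0) (Coprod (Multiplicative ℤ) (PuncturedSurfaceGroup g₁ 0))).comp
            (Coprod.inr : PuncturedSurfaceGroup g₁ 0 →* Coprod (Multiplicative ℤ) (PuncturedSurfaceGroup g₁ 0))) ∘
          fun j => a (r := 0) j * b j * (a j)⁻¹ * (b j)⁻¹ := by
      funext j
      simp only [Function.comp_apply, map_mul, map_inv]
      rw [a, b, hΦa, hΦa, hfA_right, hfA_right]; rfl
    rw [this]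
    exact map_prod_comm_eq_one_zero (M :=
        Coprod (PuncturedSurfaceGroup m 0) (Coprod (Multiplicative ℤ) (PuncturedSurfaceGroup g₁ 0))) g₁
        ((Coprod.inr : Coprod (Multiplicative ℤ) (PuncturedSurfaceGroup g₁ 0) →*
            Coprod (PuncturedSurfaceGroup m 0) (Coprod (Multiplicative ℤ) (PuncturedSurfaceGroup g₁ 0))).comp
        (Coprod.inr : PuncturedSurfaceGroup g₁ 0 →* Coprod (Multiplicative ℤ) (PuncturedSurfaceGroup g₁ 0)))
  have hΦCl : Φ Cl = 1 := by
    rw [hCl, map_list_prod, List.map_map]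
    exact List.prod_eq_one (M :=
        Coprod (PuncturedSurfaceGroup m 0) (Coprod (Multiplicative ℤ) (PuncturedSurfaceGroup g₁ 0))) fun y hy => by
      obtain ⟨j, -, rfl⟩ := List.mem_map.mp hy
      simp only [Function.comp_apply]
      split_ifs
      · exact hΦc j
      · exact map_one Φ
  have hKΦ : K ≤ Φ.ker := by
    refine Subgroup.normalClosure_le_normal ?_
    rintro x ((hx | hx) | ⟨j, rfl⟩)
    · rw [SetLike.mem_coe, MonoidHom.mem_ker, hx, hΦbm]
    · rw [Set.mem_singleton_iff] at hx
      rw [SetLike.mem_coe, MonoidHom.mem_ker, hx, hδ, map_mul, map_mul, map_inv, map_inv,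
        hΦCl, hΦXr, hΦbm, inv_one, one_mul, one_mul]
    · rw [SetLike.mem_coe, MonoidHom.mem_ker]; exact hΦc j
  let Φb : PuncturedSurfaceGroup (m + (1 + g₁)) r ⧸ K →*
      Coprod (PuncturedSurfaceGroup m 0) (Coprod (Multiplicative ℤ) (PuncturedSurfaceGroup g₁ 0)) :=
    QuotientGroup.lift K (M :=
        Coprod (PuncturedSurfaceGroup m 0) (Coprod (Multiplicative ℤ) (PuncturedSurfaceGroup g₁ 0))) Φ hKΦ
  have hΦb : ∀ x : PuncturedSurfaceGroup (m + (1 + g₁)) r, Φb (QuotientGroup.mk x) = Φ x := fun x =>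
    QuotientGroup.lift_mk' K hKΦ x
  -- (2) `Ψ : Coprod (PuncturedSurfaceGroup m 0) (Coprod (Multiplicative ℤ) (PuncturedSurfaceGroup g₁ 0)) → Γ/K`
  let f₀ : puncturedSurfaceGen m 0 → PuncturedSurfaceGroup (m + (1 + g₁)) r ⧸ K :=
    Sum.elim (fun q => QuotientGroup.mk (PresentedGroup.of (Sum.inl (Fin.castAdd (1 + g₁) q.1, q.2)))) Fin.elim0
  have hf₀rel : ∀ v ∈ ({relator m 0} : Set (FreeGroup (puncturedSurfaceGen m 0))),
      FreeGroup.lift f₀ v = 1 := by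
    intro v hv
    rw [Set.mem_singleton_iff] at hv
    rw [hv, lift_relator, List.finRange_zero, List.map_nil, List.prod_nil, mul_one]
    have : (fun i : Fin m => f₀ (Sum.inl (i, false)) * f₀ (Sum.inl (i, true)) * (f₀ (Sum.inl (i, false)))⁻¹ *
        (f₀ (Sum.inl (i, true)))⁻¹) = (QuotientGroup.mk' K) ∘ fun i => a (r := r) (Fin.castAdd (1 + g₁) i) *
          b (Fin.castAdd (1 + g₁) i) * (a (Fin.castAdd (1 + g₁) i))⁻¹ * (b (Fin.castAdd (1 + g₁) i))⁻¹ := by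
      funext i; simp only [f₀, Sum.elim_inl, Function.comp_apply, map_mul, map_inv]; rfl
    rw [this, ← List.map_map, ← map_list_prod, ← hXl', QuotientGroup.mk'_apply, QuotientGroup.eq_one_iff]
    exact hXlK
  let ψ₀ : PuncturedSurfaceGroup m 0 →* PuncturedSurfaceGroup (m + (1 + g₁)) r ⧸ K := PresentedGroup.toGroup hf₀rel
  have hψ₀ : ∀ (i : Fin m) (bit : Bool), ψ₀ (PresentedGroup.of (Sum.inl (i, bit))) =
      QuotientGroup.mk (PresentedGroup.of (Sum.inl (Fin.castAdd (1 + g₁) i, bit))) :=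
    fun i bit => PresentedGroup.toGroup.of hf₀rel
  let f₁ : puncturedSurfaceGen g₁ 0 → PuncturedSurfaceGroup (m + (1 + g₁)) r ⧸ K :=
    Sum.elim (fun q => QuotientGroup.mk (PresentedGroup.of (Sum.inl (Fin.natAdd m (Fin.natAdd 1 q.1), q.2)))) Fin.elim0
  have hf₁rel : ∀ v ∈ ({relator g₁ 0} : Set (FreeGroup (puncturedSurfaceGen g₁ 0))),
      FreeGroup.lift f₁ v = 1 := by
    intro v hv
    rw [Set.mem_singleton_iff] at hv
    rw [hv, lift_relator, List.finRange_zero, List.map_nil, List.prod_nil, mul_one]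
    have : (fun j : Fin g₁ => f₁ (Sum.inl (j, false)) * f₁ (Sum.inl (j, true)) * (f₁ (Sum.inl (j, false)))⁻¹ *
        (f₁ (Sum.inl (j, true)))⁻¹) = (QuotientGroup.mk' K) ∘ fun j => a (r := r) (Fin.natAdd m (Fin.natAdd 1 j)) *
          b (Fin.natAdd m (Fin.natAdd 1 j)) * (a (Fin.natAdd m (Fin.natAdd 1 j)))⁻¹ *
          (b (Fin.natAdd m (Fin.natAdd 1 j)))⁻¹ := by
      funext j; simp only [f₁, Sum.elim_inl, Function.comp_apply, map_mul, map_inv]; rfl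
    rw [this, ← List.map_map, ← map_list_prod, ← hXr', QuotientGroup.mk'_apply, QuotientGroup.eq_one_iff]
    exact hXrK
  let ψ₁ : PuncturedSurfaceGroup g₁ 0 →* PuncturedSurfaceGroup (m + (1 + g₁)) r ⧸ K := PresentedGroup.toGroup hf₁rel
  have hψ₁ : ∀ (j : Fin g₁) (bit : Bool), ψ₁ (PresentedGroup.of (Sum.inl (j, bit))) =
      QuotientGroup.mk (PresentedGroup.of (Sum.inl (Fin.natAdd m (Fin.natAdd 1 j), bit))) :=
    fun j bit => PresentedGroup.toGroup.of hf₁rel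
  let ψt : Multiplicative ℤ →* PuncturedSurfaceGroup (m + (1 + g₁)) r ⧸ K :=
    zpowersHom _ (QuotientGroup.mk (a km))
  have hψt : ψt (Multiplicative.ofAdd 1) = QuotientGroup.mk (a km) := by
    simp [ψt, zpowersHom_apply]
  let Ψ : Coprod (PuncturedSurfaceGroup m 0) (Coprod (Multiplicative ℤ) (PuncturedSurfaceGroup g₁ 0)) →*
      PuncturedSurfaceGroup (m + (1 + g₁)) r ⧸ K := Coprod.lift ψ₀ (Coprod.lift ψt ψ₁)
  -- (3) the two compositions
  have h1 : Ψ.comp Φb = MonoidHom.id _ := by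
    refine QuotientGroup.monoidHom_ext _ (PresentedGroup.ext fun x => ?_)
    change Ψ (Φb (QuotientGroup.mk (PresentedGroup.of x))) = QuotientGroup.mk (PresentedGroup.of x)
    rw [hΦb, hΦof]
    rcases x with ⟨i, bit⟩ | j
    · change Ψ (fA i bit) = _
      induction i using Fin.addCases with
      | left i₀ =>
        rw [hfA_left]
        show Coprod.lift ψ₀ _ (Coprod.inl _) = _
        rw [Coprod.lift_apply_inl, hψ₀]
      | right k =>
        induction k using Fin.addCases with
        | left z =>
          rw [hfA_mid]
          have hz : z = 0 := Fin.ext (by have := z.2; omega)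
          subst hz
          cases bit
          · rw [if_neg (by simp)]
            show Coprod.lift ψ₀ (Coprod.lift ψt ψ₁) (Coprod.inr (Coprod.inl _)) = _
            rw [Coprod.lift_apply_inr, Coprod.lift_apply_inl, hψt, hkm']
            rfl
          · rw [if_pos rfl, map_one, eq_comm, hkm', QuotientGroup.eq_one_iff]
            exact hbK
        | right j₀ =>
          rw [hfA_right]
          show Coprod.lift ψ₀ (Coprod.lift ψt ψ₁) (Coprod.inr (Coprod.inr _)) = _
          rw [Coprod.lift_apply_inr, Coprod.lift_apply_inr, hψ₁]
    · change Ψ 1 = QuotientGroup.mk (c j)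
      rw [map_one, eq_comm, QuotientGroup.eq_one_iff]
      exact hcK j
  have e₀ : (Φb.comp Ψ).comp Coprod.inl = (MonoidHom.id (
      Coprod (PuncturedSurfaceGroup m 0) (Coprod (Multiplicative ℤ) (PuncturedSurfaceGroup g₁ 0)))).comp Coprod.inl := by
    refine PresentedGroup.ext (G :=
        Coprod (PuncturedSurfaceGroup m 0) (Coprod (Multiplicative ℤ) (PuncturedSurfaceGroup g₁ 0))) fun y => ?_
    change Φb (Ψ (Coprod.inl (PresentedGroup.of y))) = Coprod.inl (PresentedGroup.of y)
    rcases y with ⟨i, bit⟩ | j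
    · show Φb (Coprod.lift ψ₀ _ (Coprod.inl (PresentedGroup.of _))) = _
      rw [Coprod.lift_apply_inl, hψ₀, hΦb, hΦa, hfA_left]
    · exact Fin.elim0 j
  have et : ((Φb.comp Ψ).comp Coprod.inr).comp Coprod.inl =
      ((MonoidHom.id (Coprod (PuncturedSurfaceGroup m 0) (Coprod (Multiplicative ℤ) (PuncturedSurfaceGroup g₁ 0)))).comp
        Coprod.inr).comp Coprod.inl := by
    refine MonoidHom.ext_mint (M :=
        Coprod (PuncturedSurfaceGroup m 0) (Coprod (Multiplicative ℤ) (PuncturedSurfaceGroup g₁ 0))) ?_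
    change Φb (Ψ (Coprod.inr (Coprod.inl (Multiplicative.ofAdd 1)))) = Coprod.inr (Coprod.inl (Multiplicative.ofAdd 1))
    show Φb (Coprod.lift ψ₀ (Coprod.lift ψt ψ₁) (Coprod.inr (Coprod.inl _))) = _
    rw [Coprod.lift_apply_inr, Coprod.lift_apply_inl, hψt, hΦb]
    exact hΦam
  have e₁ : ((Φb.comp Ψ).comp Coprod.inr).comp Coprod.inr =
      ((MonoidHom.id (Coprod (PuncturedSurfaceGroup m 0) (Coprod (Multiplicative ℤ) (PuncturedSurfaceGroup g₁ 0)))).comp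
        Coprod.inr).comp Coprod.inr := by
    refine PresentedGroup.ext (G :=
        Coprod (PuncturedSurfaceGroup m 0) (Coprod (Multiplicative ℤ) (PuncturedSurfaceGroup g₁ 0))) fun y => ?_
    change Φb (Ψ (Coprod.inr (Coprod.inr (PresentedGroup.of y)))) = Coprod.inr (Coprod.inr (PresentedGroup.of y))
    rcases y with ⟨j, bit⟩ | j
    · show Φb (Coprod.lift ψ₀ (Coprod.lift ψt ψ₁) (Coprod.inr (Coprod.inr (PresentedGroup.of _)))) = _
      rw [Coprod.lift_apply_inr, Coprod.lift_apply_inr, hψ₁, hΦb, hΦa, hfA_right]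
    · exact Fin.elim0 j
  have h2 : Φb.comp Ψ = MonoidHom.id _ := Coprod.hom_ext e₀ (Coprod.hom_ext et e₁)
  refine ⟨hKn, MonoidHom.toMulEquiv Φb Ψ h1 h2, fun i bit => ?_, ?_, fun j bit => ?_⟩
  · rw [MonoidHom.toMulEquiv_apply, hΦb, hΦa, hfA_left]
  · rw [MonoidHom.toMulEquiv_apply, hΦb]
    exact hΦam
  · rw [MonoidHom.toMulEquiv_apply, hΦb, hΦa, hfA_right]

end PuncturedSurfaceGroup

end Literature.GroupTheory.CombinatorialGroupTheory
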